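import Summits.Ventures.HSemireg.Pad4TowerCrossPhase

/-!
# Venture HSemireg — PAD-4: RULE D on the balanced lattice 𝔅(μ₄) (all four phases), as a finite decidable predicate

HONEST FRAMING. Lean index of the computation cell `pub-hsemireg` (S4-PUSH, H2 door PAD-4), typed by the Ventures-side typer
`hodge-lit-semireg-typer-2` (g2). Sixth `Pad4Tower*` file. It supplies the one piece the consumer seat `hodge-semireg-assembly-p1`
named as missing for the μ₄ form of THEOREM X∞ (cell INBOX l.30705 «what the μ₄ theorem still lacks is ONLY a typed μ₄ RULE D»;
`W2-KERNEL-RUNGS-assembly-p1-g0.md` «μ₄ lift = typing (μ₄ RULE D + μ₄ kills on MCell)»): **RULE D of PAD4-BALANCED-search-1.md §1′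
(«diagonal criterion on 𝔅 at adapted constituents, combinatorial form») = bc5-plan g4 memo (0.3)**, on the finite 𝔅(μ₄)
configurations `MConfig` of `Pad4TowerCrossPhase` (cells `Fin 4 → (α, Re β, Im β)`, classes only, mode I), with ALL FOUR null
directions — the (F1ℝ) file `Pad4TowerLemmaT` has the two real ones. The sibling file `Pad4TowerRuleDMu4Slice` PROVES that on the
(F1ℝ) slice this predicate IS `Pad4TowerLemmaT.RuleDN ∕ RuleDP ∕ RuleDClosed`.

TEXT OF RECORD. PAD4-BALANCED §1′ (v2.9 93790c5bf8784622; the §1′ block is byte-identical since v0.2): «FRAMES. On a factor, an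
antipodal pair of null directions (w, −w) is a FRAME … c_{±w} = (α ± wβ)∕2 … A point is ADAPTED to the frame iff β ∈ ℝw̄, i.e. its
phase is ±w or β = 0 … A leg in direction w changes c_w only. … RULE D (diagonal criterion on 𝔅 at adapted constituents,
combinatorial form). … Call a frame coordinate (f, r) of Z SERVED if Z has a leg in direction r on f (N: a P below along it with
entry; P: an N above), and choose on each singly-served factor the frame containing the served direction. Then Z passes the diagonal
criterion iff for every pair (g,j) and every two UNSERVED coordinates (g,r), (j,r′): c_r(x_g) = c_{r′}(x_j), or Z has the (r2a)
partner moving exactly {(g,r),(j,r′)}. (Doubly-served factors impose nothing; an unserved factor contributes both its coordinates.)»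
Memo v4.1 df3e4f41db3c2fcf (0.1)–(0.3) (byte-identical in v4.7): the same, with «β = 0 points have a = b and are adapted to every
frame», legs «Z ∓ d·n_r^{(f)} … PRESENT in the support WITH NON-ZERO ENTRY», covers «a present class Z ∓ (a·n_r^{(g)} +
b·n_{r′}^{(j)}), a, b ≥ 1», «a support S is RULE-D-CLOSED if every class of S passes with legs∕covers inside S».

CONVENTIONS (all predicates are `abbrev`s over finite data — decidable; `decide +kernel` on concrete configurations). Directions are
the phases `k : Fin 4` of `Pad4TowerCrossPhase.step k = n_{i^k} = ℓ_{i^k}.pt`; the frame of `k` is `{k, k+2}`. `coord x k` is TWICE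
the frame coordinate `c_{i^k}(x)` (to stay in `ℤ`): `α + Re(i^k β)`; `Adapted x k` says `β ∈ ℝ·conj(i^k)`. Service is
`Pad4TowerCrossPhase.UPartner` (the partner agrees off the factor and lies `d ≥ 1` null steps of direction `k` below ∕ above).
«Unserved coordinate of the chosen frame on a factor that is not doubly served» is made LOCAL as `¬ SettledBelow`: the served
directions of the factor are `⊆ {k+2}` (served in `k` itself ⇒ served; served off the frame ⇒ the chosen frame is the other one, or
the factor is doubly served; served only in the antipode `k+2` ⇒ frame `{k,k+2}`, `(f,k)` unserved — exactly (0.3)). Entries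
(«with non-zero entry») are mode-I data not carried by `MConfig`, as in every `Pad4Tower*` file.
FLAG F-1 (apex factors, the one place where (0.3) leaves a choice). At a point with `β ≠ 0` the frame is unique and a cover must
move EXACTLY `(g,k)`: `DirOK` = `a = k`, verbatim. At an APEX point (`β = 0`, adapted to both frames, all four coordinates equal
`α`) all four directions are in play and a cover through that factor in direction `a` resolves every coordinate `k ≠ a + 2`
(`DirOK`): this makes the predicate AT LEAST AS PERMISSIVE AS (0.3) under either frame choice (a cover accepted by (0.3) in frame
`{w,−w}` is accepted here for all four `k`), hence theorems assuming `RuleDMu4Closed` are at least as strong as the printed ones;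
and it is what the exact criterion does at a singly-served apex factor (modulo the served row `ξ̄_r ⊗ V_j`, a cover `ξ̄_a ⊗ ξ̄_b`
with `a ≠ r` has a non-zero `ξ̄_{−r}`-component — PAIR-IMAGE THEOREM). EVIDENCE that the typed predicate is the exact criterion
on the cell's objects (this typer, offline, scripts and outputs in the staging directory): (i) whole-universe dead∕alive census =
bc5-plan g3 `work/ruleD_dead_fast.py` 5c56a7a389b49161 (exact rank tests over ℚ(i)) orbit for orbit on `U5` (155∕350 alive),
`{O,ℓ,2ℓ,3ℓ,T}` (249∕350), `U6` (488∕672), `U5+2I` (178∕230), `U6+2I` (632∕840), `{O,2I,4I,ℓ,2ℓ,T}` (342∕342); (ii) class level,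
explicit support, against bc5-plan `work/ruleD_classcheck.py` 09ed188b0220cf97's exact test, on D_ML8 1b196cbe56773418, D_node
c2968d139f211ff3, D_node_decoy 2442c42c64fc9cce, the xres2 witnesses FCONE3 38449435895681a1 ∕ FCONE4 84a183f490505736 ∕ U7⁺
7c3a722966f2f15f (all: 0 failures under both) AND on 17 random sub-supports of these (28 … 1 685 failing classes each): failing sets
EQUAL in all 23 comparisons, 0 differences.
FLAG F-2 (scope, as printed). (0.3) is stated for ADAPTED constituents with μ₄ legs; Pythagorean null separations between μ₄ points
(§0 NOTE: `(t+4, 4) − (t−1, 3i)`; charges ≥ 3, 4 at α-distance 5) and (F2) points are outside it («use LEMMA F there»; memo §7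
RESIDUE R4). The predicate quantifies over the four μ₄ directions only and over adapted coordinates only: a Pythagorean leg is not seen
(stricter there), a non-adapted factor imposes nothing (more permissive there). No census universe of record contains a Pythagorean
pair.

CONTENT. §1 `coord`, `Adapted`, `isApex`, `coord_ray_self∕_antip`. §2 `MServedBelow∕Above`, `MAgree2`, `MCoverBelow∕Above`,
`SettledBelow∕Above`, `DirOK`, `CoveredBelow∕Above`. §3 **`RuleDMu4N`, `RuleDMu4P`, `RuleDMu4Closed`**. §4 THE ENGINE, PROVED
(memo §1, the three rules' common shape): `settledBelow_of_stuck` ∕ `settledAbove_of_stuck` (an adapted coordinate that is neither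
settled nor coverable forces every unequal adapted coordinate on the other factors to be settled), `stuck_of_floor`,
**`settledBelow_of_O` = (R-O)** (an `O`-factor of an `N`, all `P`-letters effective from `O` ⇒ every non-zero adapted coordinate
elsewhere is settled below), `dir_eq_of_below_ray` («from a ray DOWN: own direction only», (0.2)), **`settledBelow_of_ray` =
(R-N)∕(T1)** (the antipodal coordinate `0` of a pure-ray factor is stuck), `LevelLeTwo` + `dir_eq_of_above_tower` («from a tower
UP … antipodal NEVER in 𝒰»), **`settledAbove_of_tower` = (R-P)∕(T2)** (the antipodal coordinate `1` of a simple-tower factor of a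
`P` is stuck when every `N`-letter has relative level `≤ 2`). §5 kernel probes (`decide`):
own-phase service of `[O|O|ℓ₁|ℓ_i]`; a bare node needs two distinct directions; and bc5-plan's census lines «(N; O, 2I+2ℓ) dead in
U5, alive in U6» reproduced on the five-cell pattern.

WHAT IS NOT HERE ∕ NOT IN LEAN. The MEANING of RULE D — that `RuleDMu4N∕P` is the diagonal first-order criterion (PAIR-IMAGE
THEOREM + LEMMA F, §1∕§1′, pencil ×1 + exact checks 960∕960 ×16, 592∕592, 1 600∕1 600; memo v3.2 §13 (D) dictionary) — is the
cell's pencil, cited; the tree has no 𝔅 first-order model. Not here either: FC1, the μ₄ kill predicates beyond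
`XPhaseDeadMu4` (A∪2I′ on μ₄), PSC, `𝒰`, THEOREM X∞ on μ₄, multiplicities, sections, modes. Nothing is a statement about a
variety, a sheaf, `σ`, a seed or an abelian variety; NOTHING HERE SAYS THAT HC ∕ HC_CM ∕ HC_AV ∕ W₆ ∕ HC_Kum4Type HOLDS OR FAILS.
No `instance`, no notation, no named fact, 0 `sorry`; axioms standard.

SOURCES (sha16): PAD4-BALANCED-search-1.md v2.9 93790c5bf8784622 §0 (balanced alphabet, effective = future-causal, Pythagorean
NOTE), §1 (LEMMA F, COROLLARY (b) «any two distinct f-directions»), §1′ (FRAMES, PAIR-IMAGE THEOREM, RULE D, COMMON-APEX COROLLARY;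
block 6f85ba04683bc77b unchanged since v0.2); BC5-PLAN-g4-MEMO v4.1 df3e4f41db3c2fcf §0 (0.1)–(0.3), §1 (R-N)(R-O)(R-P) (pencil of
THEOREM X∞; referee legs s4-ref-2 g13 cce93bb8701bf60e, s4-ref g74 25db25abe3d97279); bc5-plan g3 `work/ruleD_orbit_sat.py`
606d94dcd89bf1ee (exact dictionary), `ruleD_dead_fast.py` 5c56a7a389b49161 + outputs 89bf86e42f8dcc08 ∕ 8e67190d2a76edeb ∕
0e07da018f584c45, `ruleD_classcheck.py` 09ed188b0220cf97; this typer's mirrors `ruleD_mu4_mirror.py` df7e710b94208bf4,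
`classcheck_compare.py` ff045ec78590005b (staging); `Pad4TowerCrossPhase.lean` 8f09792281b0723a (p540496), `Pad4TowerLemmaT.lean`
bfb2cc0a1a90b649 (p532659).
-/

namespace Summit.Ventures.HSemireg.Pad4Tower

open Finset

/-! ## §1 Frame coordinates on 𝔅(μ₄) -/

/-- TWICE the frame coordinate of the balanced point `x = (α, Re β, Im β)` in the null direction of phase `u = i^k`:
`coord x k = 2·c_u(x) = α + Re(u·β)` (PAD4-BALANCED §1′ FRAMES «c_{±w} = (α ± wβ)∕2»; bc5-plan g4 memo (0.1): a letter
`c·ℓ_u` has `(a,b) = (c_u, c_{−u}) = (c, 0)`, a tower `2I + c·ℓ_u` has `(c+1, 1)`). Doubled to stay in `ℤ`. -/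
abbrev coord (x : BPoint) (k : Fin 4) : ℤ := x.1 + ![x.2.1, -x.2.2, -x.2.1, x.2.2] k

/-- `x` is ADAPTED to the frame `{k, k+2}` (§1′: «β ∈ ℝ·w̄, i.e. its phase is ±w or β = 0»): for `k` even `Im β = 0`, for
`k` odd `Re β = 0`. A μ₄-phased charged point is adapted to exactly one frame; an apex point (`β = 0`) to both. -/
abbrev Adapted (x : BPoint) (k : Fin 4) : Prop := ![x.2.2, x.2.1, x.2.2, x.2.1] k = 0

/-- an APEX point: `β = 0` (adapted to every frame, all four coordinates equal to `α`). -/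
abbrev isApex (x : BPoint) : Prop := x.2.1 = 0 ∧ x.2.2 = 0

/-- moving `e` steps along the null ray of phase `i^k` raises the coordinate `k` by `2e` … -/
theorem coord_ray_self (x : BPoint) (k : Fin 4) (e : ℤ) : coord (ray x k e) k = coord x k + 2 * e := by
  fin_cases k <;> simp [coord] <;> ring

/-- … and leaves the antipodal coordinate `k + 2` unchanged («a leg in direction w changes c_w only»). -/
theorem coord_ray_antip (x : BPoint) (k : Fin 4) (e : ℤ) : coord (ray x k e) (k + 2) = coord x (k + 2) := by
  fin_cases k <;> simp [coord] <;> ring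

/-! ## §2 Service and covers on a finite 𝔅(μ₄) configuration -/

/-- the `N`-cell `Z` is SERVED BELOW along `(f, k)`: some `P ∈ E₊` is a `k`-partner `Z − d·n_{i^k}` on `f`, `d ≥ 1`
(= `Pad4TowerCrossPhase.UPartner`; memo (0.2) «a leg of Z on factor f in null direction r … a P BELOW»). -/
abbrev MServedBelow (C : MConfig) (Z : MCell) (f k : Fin 4) : Prop := ∃ P ∈ C.upper, UPartner Z P f k

/-- the `P`-cell `P` is SERVED ABOVE along `(f, k)`: some `N ∈ E₋` is `P + e·n_{i^k}` on `f`, `e ≥ 1`. -/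
abbrev MServedAbove (C : MConfig) (P : MCell) (f k : Fin 4) : Prop := ∃ N ∈ C.lower, UPartner N P f k

/-- `X` agrees with `Z` off the two factors `g`, `j`. -/
abbrev MAgree2 (X Z : MCell) (g j : Fin 4) : Prop := ∀ h, h ≠ g → h ≠ j → X h = Z h

/-- an (r2a) COVER BELOW of `Z` moving exactly the coordinates `(g, a)` and `(j, b)` (memo (0.3): «a present class
`Z − (a′·n_a^{(g)} + b′·n_b^{(j)})`, `a′, b′ ≥ 1`»). -/
abbrev MCoverBelow (C : MConfig) (Z : MCell) (g a j b : Fin 4) : Prop :=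
  ∃ P ∈ C.upper, MAgree2 P Z g j ∧ (P g).1 < (Z g).1 ∧ Z g = ray (P g) a ((Z g).1 - (P g).1) ∧
    (P j).1 < (Z j).1 ∧ Z j = ray (P j) b ((Z j).1 - (P j).1)

/-- an (r2a) COVER ABOVE of the `P`-cell `P` moving exactly `(g, a)` and `(j, b)`. -/
abbrev MCoverAbove (C : MConfig) (P : MCell) (g a j b : Fin 4) : Prop :=
  ∃ N ∈ C.lower, MAgree2 N P g j ∧ (P g).1 < (N g).1 ∧ N g = ray (P g) a ((N g).1 - (P g).1) ∧
    (P j).1 < (N j).1 ∧ N j = ray (P j) b ((N j).1 - (P j).1)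

/-- the coordinate `(f, k)` of the `N`-cell `Z` is SETTLED BELOW: `Z` is served below on `f` in the direction `k` itself or in
a direction off the frame `{k, k+2}` — i.e. in some direction other than the antipode `k + 2`. Unsettled ⟺ the served directions
of `f` are ⊆ `{k+2}` ⟺ (§1′) `(f,k)` is an UNSERVED coordinate of the frame chosen on `f` and `f` is not doubly served. -/
abbrev SettledBelow (C : MConfig) (Z : MCell) (f k : Fin 4) : Prop := ∃ r : Fin 4, r ≠ k + 2 ∧ MServedBelow C Z f r

/-- the same above a `P`-cell. -/
abbrev SettledAbove (C : MConfig) (P : MCell) (f k : Fin 4) : Prop := ∃ r : Fin 4, r ≠ k + 2 ∧ MServedAbove C P f r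

/-- which cover directions `a` on a factor with point `x` resolve the coordinate `k`: the direction `k` itself (memo (0.3)
«the (r2a) partner moving exactly {(g,r), (j,r′)}»), and — at an APEX point only, where every antipodal pair is a frame and
(0.3) leaves the frame to the reader — any direction except the antipode `k + 2` (see the module docstring, FLAG F-1). -/
abbrev DirOK (x : BPoint) (k a : Fin 4) : Prop := a = k ∨ (isApex x ∧ a ≠ k + 2)

/-- the pair of coordinates `(g,k)`, `(j,k′)` of the `N`-cell `Z` is COVERED BELOW. -/
abbrev CoveredBelow (C : MConfig) (Z : MCell) (g k j k' : Fin 4) : Prop :=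
  ∃ a b : Fin 4, DirOK (Z g) k a ∧ DirOK (Z j) k' b ∧ MCoverBelow C Z g a j b

/-- the pair of coordinates `(g,k)`, `(j,k′)` of the `P`-cell `P` is COVERED ABOVE. -/
abbrev CoveredAbove (C : MConfig) (P : MCell) (g k j k' : Fin 4) : Prop :=
  ∃ a b : Fin 4, DirOK (P g) k a ∧ DirOK (P j) k' b ∧ MCoverAbove C P g a j b

/-! ## §3 RULE D on 𝔅(μ₄) (PAD4-BALANCED §1′ ∕ bc5-plan g4 memo (0.3), combinatorial diagonal criterion at adapted cells) -/

/-- **RULE D at an `N`-cell of a 𝔅(μ₄) configuration** (memo (0.3) verbatim: «Z passes the diagonal criterion iff for every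
two UNSERVED coordinates (g, r), (j, r′) on DIFFERENT factors: c_r(x_g) = c_{r′}(x_j), or Z has the (r2a) partner moving exactly
{(g,r), (j,r′)} … Doubly-served factors impose nothing; an unserved factor contributes both coordinates»): for all factors
`g ≠ j` and all directions `k`, `k′` to whose frames the two factor points are adapted, unequal coordinates are settled below on
one side or covered below. -/
abbrev RuleDMu4N (C : MConfig) (Z : MCell) : Prop :=
  ∀ g j : Fin 4, g ≠ j → ∀ k k' : Fin 4, Adapted (Z g) k → Adapted (Z j) k' → coord (Z g) k ≠ coord (Z j) k' →
    SettledBelow C Z g k ∨ SettledBelow C Z j k' ∨ CoveredBelow C Z g k j k'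

/-- **RULE D at a `P`-cell** (same, with service and covers ABOVE). -/
abbrev RuleDMu4P (C : MConfig) (P : MCell) : Prop :=
  ∀ g j : Fin 4, g ≠ j → ∀ k k' : Fin 4, Adapted (P g) k → Adapted (P j) k' → coord (P g) k ≠ coord (P j) k' →
    SettledAbove C P g k ∨ SettledAbove C P j k' ∨ CoveredAbove C P g k j k'

/-- a RULE-D-CLOSED 𝔅(μ₄) configuration (memo (0.3): «a support S is RULE-D-CLOSED if every class of S passes with legs∕covers
inside S»). -/
abbrev RuleDMu4Closed (C : MConfig) : Prop := (∀ Z ∈ C.lower, RuleDMu4N C Z) ∧ (∀ P ∈ C.upper, RuleDMu4P C P)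

/-! ## §4 The engine: stuck coordinates force service elsewhere (memo §1 (R-O), (R-N), the shape of (R-P)) -/

section Engine

variable {C : MConfig}

/-- **the engine below**: if the adapted coordinate `(f₀, r₀)` of the `N`-cell `Z` is neither settled nor coverable below, RULE D
forces every adapted coordinate with a different value on every other factor to be settled below. -/
theorem settledBelow_of_stuck {Z : MCell} (hZ : RuleDMu4N C Z) {f₀ r₀ : Fin 4} (had₀ : Adapted (Z f₀) r₀)
    (hstuck : ¬ SettledBelow C Z f₀ r₀) (hnocov : ∀ j k', ¬ CoveredBelow C Z f₀ r₀ j k')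
    {g k : Fin 4} (hg : g ≠ f₀) (hadk : Adapted (Z g) k) (hne : coord (Z g) k ≠ coord (Z f₀) r₀) :
    SettledBelow C Z g k := by
  rcases hZ f₀ g (Ne.symm hg) r₀ k had₀ hadk (Ne.symm hne) with h | h | h
  · exact absurd h hstuck
  · exact h
  · exact absurd h (hnocov g k)

/-- **the engine above** (the shape of (R-P)): the same at a `P`-cell with service and covers above. -/
theorem settledAbove_of_stuck {P : MCell} (hP : RuleDMu4P C P) {f₀ r₀ : Fin 4} (had₀ : Adapted (P f₀) r₀)
    (hstuck : ¬ SettledAbove C P f₀ r₀) (hnocov : ∀ j k', ¬ CoveredAbove C P f₀ r₀ j k')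
    {g k : Fin 4} (hg : g ≠ f₀) (hadk : Adapted (P g) k) (hne : coord (P g) k ≠ coord (P f₀) r₀) :
    SettledAbove C P g k := by
  rcases hP f₀ g (Ne.symm hg) r₀ k had₀ hadk (Ne.symm hne) with h | h | h
  · exact absurd h hstuck
  · exact h
  · exact absurd h (hnocov g k)

/-- a FLOOR factor: no `P`-cell lies strictly below `Z` on `f₀` in causal height `α` (e.g. `Z f₀ = O` when every `P`-letter is
effective from `O` — memo (0.2) (T3) «from O DOWN: nothing»). Then `(f₀, r₀)` is neither settled nor coverable below. -/
theorem stuck_of_floor {Z : MCell} {f₀ : Fin 4} (hfloor : ∀ P ∈ C.upper, ¬ (P f₀).1 < (Z f₀).1) (r₀ : Fin 4) :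
    ¬ SettledBelow C Z f₀ r₀ ∧ ∀ j k', ¬ CoveredBelow C Z f₀ r₀ j k' := by
  refine ⟨?_, ?_⟩
  · rintro ⟨r, -, P, hP, -, hlt, -⟩
    exact hfloor P hP hlt
  · rintro j k' ⟨a, b, -, -, P, hP, -, hlt, -⟩
    exact hfloor P hP hlt

/-- **(R-O) of memo §1**: at a RULE-D `N`-cell with an `O`-FACTOR `f₀` (`Z f₀ = O = (0,0,0)`), if every `P`-letter is effective
from `O` (`α ≥ |β|`, the arena after the apex translation), then every adapted coordinate with a NON-ZERO value on every other
factor is settled below («every charged factor of Z is served in each of its non-zero coordinates»). -/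
theorem settledBelow_of_O {Z : MCell} (hZ : RuleDMu4N C Z) (hcone : ∀ P ∈ C.upper, ∀ f, Effective (P f))
    {f₀ : Fin 4} (hO : Z f₀ = (0, 0, 0)) {g k : Fin 4} (hg : g ≠ f₀) (hadk : Adapted (Z g) k)
    (hne : coord (Z g) k ≠ 0) : SettledBelow C Z g k := by
  have hfloor : ∀ P ∈ C.upper, ¬ (P f₀).1 < (Z f₀).1 := fun P hP hlt => by
    have := (hcone P hP f₀).1
    rw [hO] at hlt
    simp at hlt
    omega
  obtain ⟨hstuck, hnocov⟩ := stuck_of_floor hfloor (0 : Fin 4)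
  refine settledBelow_of_stuck hZ (by rw [hO]; decide) hstuck hnocov hg hadk ?_
  rw [hO]; simpa [coord] using hne

/-- below a PURE RAY only its own direction is available (memo (0.2): «from a ray (c,0)_u DOWN: own direction u only»): if
`Z f = c·ℓ_{i^k₀}` (`c ≥ 1`) and `P f` is effective from `O` with `Z f = P f + d·n_{i^r}`, `d ≥ 1`, then `r = k₀`. -/
theorem dir_eq_of_below_ray {c : ℤ} (hc : 1 ≤ c) {k₀ r : Fin 4} {y : BPoint} (hy : Effective y)
    (hlt : y.1 < (lpt c k₀).1) (hray : lpt c k₀ = ray y r ((lpt c k₀).1 - y.1)) : r = k₀ := by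
  fin_cases k₀ <;> fin_cases r <;> simp [lpt, ray, Effective, Prod.ext_iff] at hy hlt hray ⊢ <;> nlinarith

/-- **(R-N)∕(T1) of memo §1–(0.2)**: at a RULE-D `N`-cell with a PURE-RAY factor `i` (`Z i = c·ℓ_{i^k₀}`, `c ≥ 1`), with all
`P`-letters effective from `O`, the antipodal coordinate `(i, k₀+2)` (value `0`) is neither settled nor coverable below; hence
every adapted coordinate with a non-zero value on every other factor is settled below. -/
theorem settledBelow_of_ray {Z : MCell} (hZ : RuleDMu4N C Z) (hcone : ∀ P ∈ C.upper, ∀ f, Effective (P f))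
    {i k₀ : Fin 4} {c : ℤ} (hc : 1 ≤ c) (hray : Z i = lpt c k₀) {g k : Fin 4} (hg : g ≠ i) (hadk : Adapted (Z g) k)
    (hne : coord (Z g) k ≠ 0) : SettledBelow C Z g k := by
  -- every P below Z on i lies along the own direction k₀
  have hdir : ∀ P : MCell, Effective (P i) → ∀ r, (P i).1 < (Z i).1 → Z i = ray (P i) r ((Z i).1 - (P i).1) → r = k₀ :=
    fun P hP r hlt hr => dir_eq_of_below_ray hc hP (by rw [← hray]; exact hlt) (by rw [← hray]; exact hr)
  have hstuck : ¬ SettledBelow C Z i (k₀ + 2) := by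
    rintro ⟨r, hr, P, hP, -, hlt, hrr⟩
    have := hdir P (hcone P hP i) r hlt hrr
    subst this
    exact hr (by fin_cases r <;> decide)
  have hnocov : ∀ j k', ¬ CoveredBelow C Z i (k₀ + 2) j k' := by
    rintro j k' ⟨a, b, ha, -, P, hP, -, hlt, hra, -⟩
    have := hdir P (hcone P hP i) a hlt hra
    subst this
    rcases ha with h | ⟨⟨h1, h2⟩, -⟩
    · exact absurd h (by fin_cases a <;> decide)
    · rw [hray] at h1 h2
      fin_cases a <;> simp [lpt, ray] at h1 h2 <;> omega
  refine settledBelow_of_stuck hZ (by rw [hray]; fin_cases k₀ <;> simp [lpt, ray, Adapted]) hstuck hnocov hg hadk ?_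
  rw [hray]
  have : coord (lpt c k₀) (k₀ + 2) = 0 := by fin_cases k₀ <;> simp [coord, lpt, ray]
  rwa [this]

/-- a letter of RELATIVE LEVEL `α − |β| ≤ 2`, μ₄-phased (`β` on one axis): the letters of the arena `𝒰` (apex `O`, pure rays
`c·ℓ_u`, simple towers `2I + c·ℓ_u`, memo (0.1) «relative level t := α − |β| ∈ {0, 2}») and the bare node `2I` all qualify; the
antipodal raise of a tower (`(c+1, 1+e)_u`, level `≥ 4`) and the nodes `4I, 6I, …` do not. Written without `|·|` for `omega`. -/
abbrev LevelLeTwo (y : BPoint) : Prop :=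
  (y.2.2 = 0 ∧ (y.1 ≤ y.2.1 + 2 ∨ y.1 ≤ -y.2.1 + 2)) ∨ (y.2.1 = 0 ∧ (y.1 ≤ y.2.2 + 2 ∨ y.1 ≤ -y.2.2 + 2))

/-- above a SIMPLE TOWER only its own direction stays at level `≤ 2` (memo (0.2): «from a tower (c+1,1)_u … UP: own to T_{c+e,u};
antipodal to (c+1, 1+e) — NEVER in 𝒰 (relative level ≥ 4)»; an orthogonal raise is not μ₄-phased): if `y` is a level-`≤ 2` letter
`e ≥ 1` null steps of direction `r` above `T_{c,i^k₀} = 2I + c·ℓ_{i^k₀}` (`c ≥ 1`), then `r = k₀`. -/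
theorem dir_eq_of_above_tower {c : ℤ} (hc : 1 ≤ c) {k₀ r : Fin 4} {y : BPoint} (hy : LevelLeTwo y)
    (hlt : (ray (2, 0, 0) k₀ c).1 < y.1) (hray : y = ray (ray (2, 0, 0) k₀ c) r (y.1 - (ray (2, 0, 0) k₀ c).1)) : r = k₀ := by
  fin_cases k₀ <;> fin_cases r <;> simp [ray, LevelLeTwo, Prod.ext_iff] at hy hlt hray ⊢ <;> omega

/-- **(R-P)∕(T2) of memo §1–(0.2)**: at a RULE-D `P`-cell with a SIMPLE-TOWER factor `j` (`P j = 2I + c·ℓ_{i^k₀}`, `c ≥ 1`), if every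
`N`-letter has relative level `≤ 2` (all of `𝒰`), the antipodal coordinate `(j, k₀+2)` (value `2`, i.e. `b = 1`) is neither settled nor
coverable above; hence every adapted coordinate with value `≠ 2` on every other factor is settled above («EVERY unserved coordinate on
every factor k ≠ j equals 1»). The «consequently» clauses of (R-P) (which server letters) are alphabet facts left to the consumer. -/
theorem settledAbove_of_tower {P : MCell} (hP : RuleDMu4P C P) (hlow : ∀ N ∈ C.lower, ∀ f, LevelLeTwo (N f))
    {j k₀ : Fin 4} {c : ℤ} (hc : 1 ≤ c) (htow : P j = ray (2, 0, 0) k₀ c) {g k : Fin 4} (hg : g ≠ j) (hadk : Adapted (P g) k)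
    (hne : coord (P g) k ≠ 2) : SettledAbove C P g k := by
  have hdir : ∀ N : MCell, LevelLeTwo (N j) → ∀ r, (P j).1 < (N j).1 → N j = ray (P j) r ((N j).1 - (P j).1) → r = k₀ :=
    fun N hN r hlt hr => dir_eq_of_above_tower hc hN (by rw [← htow]; exact hlt) (by rw [← htow]; exact hr)
  have hstuck : ¬ SettledAbove C P j (k₀ + 2) := by
    rintro ⟨r, hr, N, hN, -, hlt, hrr⟩
    have := hdir N (hlow N hN j) r hlt hrr
    subst this
    exact hr (by fin_cases r <;> decide)
  have hnocov : ∀ j' k', ¬ CoveredAbove C P j (k₀ + 2) j' k' := by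
    rintro j' k' ⟨a, b, ha, -, N, hN, -, hlt, hra, -⟩
    have := hdir N (hlow N hN j) a hlt hra
    subst this
    rcases ha with h | ⟨⟨h1, h2⟩, -⟩
    · exact absurd h (by fin_cases a <;> decide)
    · rw [htow] at h1 h2
      fin_cases a <;> simp at h1 h2 <;> omega
  refine settledAbove_of_stuck hP (by rw [htow]; fin_cases k₀ <;> simp [Adapted]) hstuck hnocov hg hadk ?_
  rw [htow]
  have : coord (ray (2, 0, 0) k₀ c) (k₀ + 2) = 2 := by fin_cases k₀ <;> simp [coord]
  rwa [this]

end Engine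



/-! ## §5 Kernel probes (the predicate computes, and agrees with bc5-plan's exact census lines on these patterns; NOT certificates
about the cell's supports; cells and configurations are named `def`s so that the `Decidable` instance is found quickly) -/

section Probes

/-- the apex `O` as a factor point. -/
abbrev ptO : BPoint := (0, 0, 0)

/-- `N = [O|O|ℓ₁|ℓ_i]` (phases `1` and `i` = directions `0` and `1`): the smallest genuinely μ₄ pattern. -/
def nOwnPhase : MCell := mcellOf ptO ptO (lpt 1 0) (lpt 1 1)

/-- `nOwnPhase` with its two own cancellations `[O|O|O|ℓ_i]`, `[O|O|ℓ₁|O]` below. -/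
def ownPhaseProbe : MConfig where
  lower := {nOwnPhase}
  upper := {mcellOf ptO ptO ptO (lpt 1 1), mcellOf ptO ptO (lpt 1 0) ptO}

/-- the same with the cancellation `[O|O|ℓ₁|O]` removed. -/
def ownPhaseProbe' : MConfig where
  lower := {nOwnPhase}
  upper := {mcellOf ptO ptO ptO (lpt 1 1)}

set_option synthInstance.maxSize 8192 in
set_option synthInstance.maxHeartbeats 2000000 in -- the unfolded predicate is one large decidable instance
/-- (R-O): RULE D holds at `N = [O|O|ℓ₁|ℓ_i]` when both charged factors are served own-phase below, and FAILS once one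
cancellation is removed (the `ℓ₁`-coordinate `(2, 0) = 2` is then unsettled against the `O`-coordinates `0`). [kernel, `decide`] -/
theorem ownPhaseProbe_ruleD : RuleDMu4N ownPhaseProbe nOwnPhase ∧ ¬ RuleDMu4N ownPhaseProbe' nOwnPhase := by
  constructor <;> decide +kernel

/-- `N = [O|O|O|2I]`: a bare node next to three `O`-factors. -/
def nBareNode : MCell := mcellOf ptO ptO ptO (2, 0, 0)

/-- `nBareNode` with the two legs `2I → ℓ₁`, `2I → ℓ_{−i}` below (directions `0` and `3`). -/
def bareNodeTwoDirs : MConfig := ⟨{nBareNode}, {mcellOf ptO ptO ptO (lpt 1 0), mcellOf ptO ptO ptO (lpt 1 3)}⟩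

/-- `nBareNode` with the antipodal pair of legs `2I → ℓ₁`, `2I → ℓ₋₁` (directions `0` and `2`). -/
def bareNodeAntipodal : MConfig := ⟨{nBareNode}, {mcellOf ptO ptO ptO (lpt 1 0), mcellOf ptO ptO ptO (lpt 1 2)}⟩

/-- `nBareNode` with the single leg `2I → ℓ₁`. -/
def bareNodeOneDir : MConfig := ⟨{nBareNode}, {mcellOf ptO ptO ptO (lpt 1 0)}⟩

set_option synthInstance.maxSize 8192 in
set_option synthInstance.maxHeartbeats 2000000 in -- as above
/-- a BARE NODE next to `O`-factors needs service in TWO DISTINCT directions (apex point: all four coordinates `2` are in play; one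
leg in direction `u` settles exactly the three coordinates off the antipode of `u`): `[O|O|O|2I]` passes with legs to `ℓ₁, ℓ_{−i}` and
with the antipodal pair `ℓ₁, ℓ₋₁`, and fails with `ℓ₁` alone (PAIR-IMAGE THEOREM: against an `O`-factor all four entries
`D_{rr′} = 1 − 0` of the node's pair are non-zero, so both rows of the node's frame must be served; PAD4-BALANCED §1 COROLLARY (d):
«two directions on one side of a pair absorb it unconditionally»). [kernel, `decide`] -/
theorem bareNodeProbe_ruleD :
    RuleDMu4N bareNodeTwoDirs nBareNode ∧ RuleDMu4N bareNodeAntipodal nBareNode ∧ ¬ RuleDMu4N bareNodeOneDir nBareNode := by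
  refine ⟨?_, ?_, ?_⟩ <;> decide +kernel

/-- `N = [O|O|O|T2₁]`, `T2₁ = 2I + 2ℓ₁ = (4, 2)`. -/
def nTowerNextToO : MCell := mcellOf ptO ptO ptO (ray (2, 0, 0) 0 2)

/-- `nTowerNextToO` with EVERY `U5 = {O,ℓ,2ℓ,T,T2}`-letter below `T2₁` present: `T₁ = (3,1)` (own-down, depth 1) and
`ℓ₋₁ = (1,−1)` (own-down, depth 3). -/
def towerNextToO_U5 : MConfig := ⟨{nTowerNextToO}, {mcellOf ptO ptO ptO (ray (2, 0, 0) 0 1), mcellOf ptO ptO ptO (lpt 1 2)}⟩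

/-- the same in `U6 = U5 + 3ℓ`: also `3ℓ₁ = (3,3) = T2₁ − n₋₁` (antipodal-down, depth 1). -/
def towerNextToO_U6 : MConfig :=
  ⟨{nTowerNextToO}, {mcellOf ptO ptO ptO (ray (2, 0, 0) 0 1), mcellOf ptO ptO ptO (lpt 1 2), mcellOf ptO ptO ptO (lpt 3 0)}⟩

set_option synthInstance.maxSize 8192 in
set_option synthInstance.maxHeartbeats 2000000 in -- as above
/-- bc5-plan g3's whole-universe census lines REPRODUCED: in `U5` the pair `(N; O, 2I+2ℓ)` is DEAD (`work/ruleD_dead_O-l-2l-T-T2.out`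
89bf86e42f8dcc08 «dead letter-pairs … ('N', 'O', '2I+2l')») — with every `U5`-letter below `T2₁` present the antipodal coordinate
`(3, 2) = 2 ≠ 0` of the tower stays unsettled (its only server letter is `3ℓ₁ ∉ U5`); in `U6 = U5 + 3ℓ` (`ruleD_dead_O-l-2l-3l-T-T2.out`
0e07da018f584c45: no `N`-side dead pair) it passes — the tower factor is then DOUBLY served, as (R-N)∕(R-O) demand. [kernel, `decide`] -/
theorem towerNextToO_census : ¬ RuleDMu4N towerNextToO_U5 nTowerNextToO ∧ RuleDMu4N towerNextToO_U6 nTowerNextToO := by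
  constructor <;> decide +kernel

end Probes

end Summit.Ventures.HSemireg.Pad4Tower
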